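import Literature.AlgebraicGeometry.Resolution.FFinite
import Literature.AlgebraicGeometry.Resolution.StalkSpecializesLocalization
import Mathlib.RingTheory.Localization.LocalizationLocalization
import Mathlib.RingTheory.RegularLocalRing.Defs
import Mathlib.RingTheory.Localization.Away.Basic
import Mathlib.AlgebraicGeometry.Morphisms.FiniteType
import Mathlib.AlgebraicGeometry.Noetherian
import HarnessLib

/-!
# Crux `FRationalModification` — inputs of the test-element theorem at a stalk (line `Sketch`, v7)

Support lemmas for crux stmt-ResolutionOfSingularities-15316
(`Summit.ResolutionOfSingularities.ResolutionOfSingularities.Theses.FrobeniusLadder.FRationalModification`,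
route `FrobeniusLadder`), filed by the line lead (line `Sketch`, skeleton v7, lead cycle 3).

The open stub `stub_cover` of skeleton v7 lets a construction certify F-rationality of a stalk
`S = 𝒪_{W,w}` (a Noetherian local domain of characteristic `p`) by a DIVISOR CERTIFICATE: `g ∈ 𝔪_S`,
`g ≠ 0`, with `S/(g)` Cohen–Macaulay and F-injective, PLUS the clause "`gⁿ` is a parameter test
element". The first half is a property of the divisor `V(g)` alone; the second is where knowledge
of `S` off `V(g)` enters, and the theorem that supplies it in the F-finite case is Hochster–Huneke
1989, Thm. 3.4 (named fact `Literature.RingTheory.TightClosure.HochsterHuneke1989_thm34`, filed with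
this cycle: F-finite reduced `R`, `c ∈ R°`, `R_c` regular ⇒ some `cⁿ` is a test element). This file
proves that the two hypotheses of that theorem hold at stalks in the geometric situation a
construction is in:

* `isRegularRing_away_of_generizations` — for `x ∈ X` (locally Noetherian) and `g ∈ 𝒪_{X,x}`, if
  every generization `x' ⤳ x` at which `g` is a unit has a regular local ring, then `(𝒪_{X,x})_g`
  is a regular ring (Stacks 01J7: the primes of `𝒪_{X,x}` are the generizations of `x`, tree
  `StalkSpecializesLocalization.lean`) — the ring-theoretic form of "`X` is regular off `V(g)`
  near `x`";
* `isFFinite_stalk` — stalks of a scheme locally of finite type over an F-finite field (e.g. a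
  perfect field) are F-finite (an affine neighbourhood is of finite type over `k`; Kunz: finite
  type and localisation preserve F-finiteness — tree `IsFFinite.of_finiteType`,
  `IsFFinite.of_isLocalization`).

The consumers (the certificate with its test-element clause discharged, stalkwise and along a
global effective Cartier divisor) are in `FrobeniusLadderFRationalModificationCartierCertificate.lean`.
-/

-- single-problem summit: the doubled namespace component `ResolutionOfSingularities` is forced
set_option linter.dupNamespace false

noncomputable section

open CategoryTheory AlgebraicGeometry TopologicalSpace
open IsLocalRing Literature.AlgebraicGeometry.Resolution

namespace Summit.ResolutionOfSingularities.ResolutionOfSingularities.Theorems.FRationalModification.TestElement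

/-! ## "Regular off `V(g)`" at a stalk -/

/-- **"Regular off `V(g)`" at a point, ring-theoretically.** Let `X` be a locally Noetherian scheme,
`x ∈ X`, `g ∈ 𝒪_{X,x}`. If every generization `x' ⤳ x` at which `g` becomes a unit (i.e. every point
of `Spec 𝒪_{X,x}` outside `V(g)`) has a regular local ring `𝒪_{X,x'}`, then the ring `(𝒪_{X,x})_g`
is regular: its localizations at primes are the localizations of `𝒪_{X,x}` at the primes not
containing `g`, which are the stalks `𝒪_{X,x'}` at generizations (Stacks 01J7, tree
`exists_specializes_comap_stalkSpecializes_eq`, `isLocalizationAtPrime_stalkSpecializes`).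
[cite: StacksProject, Tag 01J7; folklore] -/
theorem isRegularRing_away_of_generizations {X : Scheme.{0}} [IsLocallyNoetherian X] (x : X)
    (g : X.presheaf.stalk x)
    (h : ∀ (x' : X) (hx : x' ⤳ x), IsUnit ((X.presheaf.stalkSpecializes hx).hom g) →
      IsRegularLocalRing (X.presheaf.stalk x')) :
    IsRegularRing (Localization.Away g) := by
  let S := X.presheaf.stalk x
  let Sg := Localization.Away g
  haveI : IsNoetherianRing Sg := IsLocalization.isNoetherianRing (Submonoid.powers g) Sg inferInstance
  refine (isRegularRing_iff (R := Sg)).mpr fun Q _ => ?_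
  -- the prime `P = Q ∩ S` does not contain `g`
  let P : Ideal S := Q.comap (algebraMap S Sg)
  haveI : P.IsPrime := Ideal.IsPrime.comap _
  have hgP : g ∉ P := fun hg =>
    (IsLocalization.isPrime_iff_isPrime_disjoint (Submonoid.powers g) Sg Q).mp ‹Q.IsPrime› |>.2
      |>.le_bot ⟨Submonoid.mem_powers g, hg⟩
  -- `(S_g)_Q` is the localization of `S` at `P`
  haveI : IsLocalization.AtPrime (Localization.AtPrime Q) P :=
    IsLocalization.isLocalization_isLocalization_atPrime_isLocalization (Submonoid.powers g)
      (Localization.AtPrime Q) Q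
  -- `P` is the contraction of `𝔪_{x'}` for a generization `x' ⤳ x`, and `𝒪_{X,x'} = S_P`
  obtain ⟨x', hx, hP⟩ := exists_specializes_comap_stalkSpecializes_eq x P
  letI := (X.presheaf.stalkSpecializes hx).hom.toAlgebra
  have hM : P.primeCompl =
      ((maximalIdeal (X.presheaf.stalk x')).comap (X.presheaf.stalkSpecializes hx).hom).primeCompl :=
    Submonoid.ext fun y => by
      change y ∉ P ↔ y ∉ _
      rw [hP]
      exact Iff.rfl
  haveI hloc : IsLocalization P.primeCompl (X.presheaf.stalk x') := by
    rw [hM]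
    exact isLocalizationAtPrime_stalkSpecializes hx
  -- `g` is a unit at `x'`, so `𝒪_{X,x'}` is regular by hypothesis
  have hunit : IsUnit ((X.presheaf.stalkSpecializes hx).hom g) := by
    by_contra hng
    apply hgP
    rw [hP]
    exact Ideal.mem_comap.mpr ((mem_maximalIdeal _).mpr hng)
  haveI : IsRegularLocalRing (X.presheaf.stalk x') := h x' hx hunit
  -- transport along the `S`-isomorphism of the two localizations at `P`
  exact IsRegularLocalRing.of_ringEquiv
    (IsLocalization.algEquiv P.primeCompl (X.presheaf.stalk x') (Localization.AtPrime Q)).toRingEquiv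

/-! ## Stalks of schemes locally of finite type over an F-finite field are F-finite -/

/-- **Stalks of a `k`-scheme locally of finite type, `k` F-finite of characteristic `p`, are
F-finite.** Take an affine open neighbourhood `x ∈ U`; `Γ(X, U)` is a `k`-algebra of finite type
(`Scheme.Hom.finiteType_appLE` with `Γ(Spec k) ≅ k`), hence F-finite (Kunz; tree
`IsFFinite.of_finiteType`), and `𝒪_{X,x}` is its localisation at the prime of `x`
(`IsAffineOpen.isLocalization_stalk`), hence F-finite (`IsFFinite.of_isLocalization`).
[cite: Kunz1969, §1; folklore] -/
theorem isFFinite_stalk {p : ℕ} [Fact p.Prime] {k : Type} [Field k] [CharP k p] {e : ℕ}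
    (hk : IsFFinite p e k) {X : Scheme.{0}} (f : X ⟶ Spec (.of k)) [LocallyOfFiniteType f]
    (x : X) : IsFFinite p e (X.presheaf.stalk x) := by
  obtain ⟨U, hU, hxU, -⟩ :=
    exists_isAffineOpen_mem_and_subset (X := X) (x := x) (U := ⊤) (Opens.mem_top x)
  -- `Γ(X, U)` is a `k`-algebra of finite type
  have h1 : (f.appLE ⊤ U le_top).hom.FiniteType :=
    f.finiteType_appLE (isAffineOpen_top _) hU le_top
  have h2 : (Scheme.ΓSpecIso (.of k)).inv.hom.FiniteType :=
    RingHom.FiniteType.of_surjective _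
      (Scheme.ΓSpecIso (.of k)).symm.commRingCatIsoToRingEquiv.surjective
  let g : k →+* Γ(X, U) := (f.appLE ⊤ U le_top).hom.comp (Scheme.ΓSpecIso (.of k)).inv.hom
  letI : Algebra k Γ(X, U) := g.toAlgebra
  haveI : Algebra.FiniteType k Γ(X, U) := RingHom.finiteType_algebraMap.mp (h1.comp h2)
  -- `𝒪_{X,x}` is the localisation of `Γ(X, U)` at the prime of `x`
  letI : Algebra Γ(X, U) (X.presheaf.stalk x) :=
    TopCat.Presheaf.algebra_section_stalk X.presheaf (⟨x, hxU⟩ : U)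
  haveI := hU.isLocalization_stalk ⟨x, hxU⟩
  -- characteristic bookkeeping: `Γ(X, U)` is nontrivial (it has the prime of `x`), so `k ↪ Γ(X, U)`
  haveI : Nontrivial Γ(X, U) :=
    ⟨⟨0, 1, fun h01 => (hU.primeIdealOf ⟨x, hxU⟩).isPrime.ne_top
      ((Ideal.eq_top_iff_one _).mpr (h01 ▸ Ideal.zero_mem _))⟩⟩
  haveI : CharP Γ(X, U) p := charP_of_injective_algebraMap (algebraMap k Γ(X, U)).injective p
  exact (hk.of_finiteType Γ(X, U)).of_isLocalization (hU.primeIdealOf ⟨x, hxU⟩).asIdeal.primeCompl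
    (X.presheaf.stalk x)


end Summit.ResolutionOfSingularities.ResolutionOfSingularities.Theorems.FRationalModification.TestElement

end
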